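import Summits.NavierStokesRegularity.OSWSelfSimilar.SheetRWeakToStrong
import HarnessLib

/-!
# SHEET-ℝ weak→classical bridge, distributional form: an `H¹` pair `(Ω, Ω₁)` given by a WEAK DERIVATIVE (no representative chosen)

HONEST FRAMING (cell ns-blowup GROUP B / zone Z3, case Z3-SR-CERT; 1-D MODEL (viscous gCLM/OSW on the line); not Euler/NS;
«violates: none — MODEL»). Nothing here asserts that a profile exists.

`SheetRWeakToStrong.lean` takes the `H¹` datum as a primitive `Ω = Ω(0) + ∫₀Ω₁`.  When the energy space `E = H¹_{L²+ξ²}` is realised as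
«`Ω ∈ L²_w` with a weak derivative `Ω₁ ∈ L²_w`» — the form in which a completion / Lax–Milgram argument delivers the certified zero — the
datum is only an a.e.-class: `Ω ∈ L¹ ∩ L²` measurable, `Ω₁ ∈ L²`, and `∫ Ω ψ′ = −∫ Ω₁ ψ` for all `ψ ∈ C_c^∞`.  This file removes the choice of
representative: (i) a whole-line du Bois-Reymond lemma (`exists_ae_eq_const_of_forall_integral_deriv_mul_eq_zero`: `E ∈ L¹_loc`,
`∫ η′E = 0 ∀η ∈ C_c^∞ ⇒ E = c` a.e.) applied to `Ω − ∫₀Ω₁` gives the continuous representative `Ω̃ = c + ∫₀Ω₁ = Ω` a.e.; (ii) the tree's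
pointwise Hilbert transform does not see null sets (`hilbertTransform_congr_ae`: `Ω̃ = Ω` a.e. ⇒ `HΩ̃ = HΩ` EVERYWHERE, the integrand changing
only on a null set of `t` for each `x`), so the weak profile equation (W) transfers from `Ω` to `Ω̃`; (iii) `SheetRWeakToStrong` then makes `Ω̃` a
`C²` strong zero of `G` and an exact self-similar viscous gCLM blow-up profile (`exists_strongZero_representative_of_weakDeriv`,
`exact_viscous_selfSimilar_blowup_of_weakDeriv`). MODEL statements only. WHAT THIS IS NOT: not NS, and not the MODEL ASSEMBLY.
-/

noncomputable section

namespace Summit.NavierStokesRegularity.OSWSelfSimilar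
namespace SheetRWeakToStrongAE

open _root_.MeasureTheory _root_.Set _root_.Filter _root_.Function Literature.Analysis.Fourier Literature.Analysis.FluidPDE
  SheetRWeakProfilePV SheetRWeakToStrong
open scoped Real Topology ContDiff

/-! ### A whole-line du Bois-Reymond lemma -/

/-- **Vanishing distributional derivative on `ℝ` ⇒ a.e. constant.** If `E ∈ L¹_loc(ℝ)` and `∫ η′·E = 0` for every `C^∞` compactly
supported `η`, then `E = c` a.e. for one constant `c` (the tree's interval lemma
`Literature.Analysis.FunctionSpaces.ae_eq_const_of_forall_setIntegral_deriv_mul_eq_zero` on the windows `(−(n+1), n+1)`, whose constants agree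
on `(−1, 1)`). [folklore] -/
theorem exists_ae_eq_const_of_forall_integral_deriv_mul_eq_zero {E : ℝ → ℝ} (hE : LocallyIntegrable E)
    (h : ∀ η : ℝ → ℝ, ContDiff ℝ ∞ η → HasCompactSupport η → ∫ x, deriv η x * E x = 0) :
    ∃ c : ℝ, ∀ᵐ x : ℝ, E x = c := by
  have hwin : ∀ n : ℕ, ∃ c : ℝ, ∀ᵐ x ∂(volume.restrict (Ioo (-((n : ℝ) + 1)) ((n : ℝ) + 1))), E x = c := by
    intro n
    have hEint : IntegrableOn E (Ioo (-((n : ℝ) + 1)) ((n : ℝ) + 1)) :=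
      (hE.integrableOn_isCompact isCompact_Icc).mono_set Ioo_subset_Icc_self
    refine Literature.Analysis.FunctionSpaces.ae_eq_const_of_forall_setIntegral_deriv_mul_eq_zero hEint
      fun η hηs hηc hηsupp => ?_
    have hdη0 : ∀ x, x ∉ Ioo (-((n : ℝ) + 1)) ((n : ℝ) + 1) → deriv η x = 0 := fun x hx => by
      have : x ∉ tsupport η := fun h' => hx (hηsupp h')
      exact notMem_support.1 fun h' => this (support_deriv_subset h')
    rw [setIntegral_eq_integral_of_forall_compl_eq_zero fun x hx => by rw [hdη0 x hx, zero_mul]]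
    exact h η hηs hηc
  choose c hc using hwin
  refine ⟨c 0, ?_⟩
  have hcc : ∀ n, c n = c 0 := by
    intro n
    have hsub : Ioo (-(((0 : ℕ) : ℝ) + 1)) (((0 : ℕ) : ℝ) + 1) ⊆ Ioo (-((n : ℝ) + 1)) ((n : ℝ) + 1) := by
      refine Ioo_subset_Ioo ?_ ?_ <;> push_cast <;> linarith [n.cast_nonneg (α := ℝ)]
    have h1 : ∀ᵐ x ∂(volume.restrict (Ioo (-(((0 : ℕ) : ℝ) + 1)) (((0 : ℕ) : ℝ) + 1))), E x = c n :=
      ae_restrict_of_ae_restrict_of_subset hsub (hc n)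
    have hne : (ae (volume.restrict (Ioo (-(((0 : ℕ) : ℝ) + 1)) (((0 : ℕ) : ℝ) + 1)))).NeBot := by
      rw [ae_neBot, Ne, Measure.restrict_eq_zero]
      push_cast
      rw [Real.volume_Ioo]; norm_num
    obtain ⟨x, hx1, hx2⟩ := (h1.and (hc 0)).exists
    exact hx1.symm.trans hx2
  have hcover : (⋃ n : ℕ, Ioo (-((n : ℝ) + 1)) ((n : ℝ) + 1)) = univ := by
    refine eq_univ_of_forall fun x => mem_iUnion.2 ?_
    obtain ⟨n, hn⟩ := exists_nat_gt |x|
    exact ⟨n, by rw [mem_Ioo]; constructor <;> linarith [abs_lt.1 (hn.trans (lt_add_one _))]⟩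
  have hall : ∀ᵐ x ∂(volume.restrict (⋃ n : ℕ, Ioo (-((n : ℝ) + 1)) ((n : ℝ) + 1))), E x = c 0 := by
    rw [ae_restrict_iUnion_iff]
    intro n
    have h' := hc n
    rw [hcc n] at h'
    exact h'
  rwa [hcover, Measure.restrict_univ] at hall

/-! ### The continuous representative of a weak-derivative pair -/

/-- **Continuous representative.** If `Ω ∈ L¹_loc`, `Ω₁ ∈ L¹_loc` and `∫ Ω ψ′ = −∫ Ω₁ ψ` for all `C_c^∞` tests `ψ` (weak derivative), then
`Ω = c + ∫₀Ω₁` a.e. for one constant `c`. [folklore] -/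
theorem ae_eq_const_add_primitive_of_weakDeriv {Ω Ω₁ : ℝ → ℝ} (hΩ : LocallyIntegrable Ω) (hΩ₁ : LocallyIntegrable Ω₁)
    (hwd : ∀ ψ : ℝ → ℝ, ContDiff ℝ ∞ ψ → HasCompactSupport ψ → ∫ x, Ω x * deriv ψ x = -∫ x, Ω₁ x * ψ x) :
    ∃ c : ℝ, ∀ᵐ x : ℝ, Ω x = c + ∫ s in (0 : ℝ)..x, Ω₁ s := by
  have hii : ∀ a b, IntervalIntegrable Ω₁ volume a b := fun a b =>
    (hΩ₁.integrableOn_isCompact isCompact_uIcc).intervalIntegrable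
  have hPc : Continuous fun x => ∫ s in (0 : ℝ)..x, Ω₁ s := intervalIntegral.continuous_primitive hii 0
  obtain ⟨c, hc⟩ := exists_ae_eq_const_of_forall_integral_deriv_mul_eq_zero (E := fun x => Ω x - ∫ s in (0 : ℝ)..x, Ω₁ s)
    (hΩ.sub hPc.locallyIntegrable) fun η hηs hηc => by
      have hdc : Continuous (deriv η) := hηs.continuous_deriv (by exact_mod_cast le_top)
      have hdcs : HasCompactSupport (deriv η) := hηc.deriv
      have hi1 : Integrable fun x => deriv η x * Ω x := by
        simpa only [smul_eq_mul] using hΩ.integrable_smul_left_of_hasCompactSupport hdc hdcs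
      have hi2 : Integrable fun x => deriv η x * ∫ s in (0 : ℝ)..x, Ω₁ s := by
        simpa only [smul_eq_mul] using hPc.locallyIntegrable.integrable_smul_left_of_hasCompactSupport hdc hdcs
      have h1 : ∫ x, deriv η x * Ω x = -∫ x, Ω₁ x * η x := by
        rw [show (fun x => deriv η x * Ω x) = fun x => Ω x * deriv η x from funext fun x => mul_comm _ _, hwd η hηs hηc]
      have h2 := integral_deriv_mul_primitive hΩ₁ hηs hηc
      have h3 : ∫ x, η x * Ω₁ x = ∫ x, Ω₁ x * η x := integral_congr_ae (Eventually.of_forall fun x => mul_comm _ _)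
      simp only [mul_sub]
      rw [integral_sub hi1 hi2, h1, h2, h3]
      ring
  exact ⟨c, hc.mono fun x hx => by
    have hx' : Ω x - ∫ s in (0 : ℝ)..x, Ω₁ s = c := hx
    linarith⟩

/-! ### The pointwise Hilbert transform does not see null sets -/

/-- If `f = g` a.e., then `hilbertTransform f x = hilbertTransform g x` at EVERY `x` (for each `x` the two symmetric integrands agree for
a.e. `t`, translations and reflections being measure preserving). [folklore] -/
theorem hilbertTransform_congr_ae {f g : ℝ → ℝ} (h : f =ᵐ[volume] g) : hilbertTransform f = hilbertTransform g := by
  funext x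
  rw [hilbertTransform, hilbertTransform]
  congr 1
  refine setIntegral_congr_ae measurableSet_Ioi ?_
  have h1 : ∀ᵐ t : ℝ, f (x - t) = g (x - t) :=
    h.comp_tendsto (Measure.measurePreserving_sub_left volume x).quasiMeasurePreserving.tendsto_ae
  have h2 : ∀ᵐ t : ℝ, f (x + t) = g (x + t) :=
    h.comp_tendsto (measurePreserving_add_left volume x).quasiMeasurePreserving.tendsto_ae
  filter_upwards [h1, h2] with t ht1 ht2 _
  rw [ht1, ht2]

/-! ### The bridge for a weak-derivative pair -/

/-- **Weak-derivative pair ⇒ `C²` strong zero (up to a null set).** Let `Ω ∈ L¹ ∩ L²` and `Ω₁ ∈ L²` be an `H¹` pair in the distributional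
sense (`∫ Ω ψ′ = −∫ Ω₁ ψ` for all `C_c^∞` tests), `ν ≠ 0`, and assume the weak profile equation (W) of `SheetRWeakToStrong` for `(Ω, Ω₁)`.
Then the continuous representative `Ω̃` (`= Ω` a.e., `= Ω̃(0) + ∫₀Ω₁`) is `C²`, integrable, has `HΩ̃ = HΩ`, and is a POINTWISE zero of the
certificate's map: `Ω̃ + ½X·Ω̃′ + a(∫₀^X HΩ̃)Ω̃′ − HΩ̃·Ω̃ − νΩ̃″ = 0` at every `X`. MODEL statement; existence of such a pair is NOT asserted.
[folklore] -/
theorem exists_strongZero_representative_of_weakDeriv {a ν : ℝ} {Ω Ω₁ : ℝ → ℝ} (hν : ν ≠ 0)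
    (hΩi : Integrable Ω) (hΩ2 : MemLp Ω 2) (hΩ₁ : MemLp Ω₁ 2)
    (hwd : ∀ ψ : ℝ → ℝ, ContDiff ℝ ∞ ψ → HasCompactSupport ψ → ∫ x, Ω x * deriv ψ x = -∫ x, Ω₁ x * ψ x)
    (hweak : ∀ ψ : ℝ → ℝ, ContDiff ℝ ∞ ψ → HasCompactSupport ψ →
      (∫ x, (Ω x + 1 / 2 * x * Ω₁ x + a * (∫ s in (0 : ℝ)..x, hilbertTransform Ω s) * Ω₁ x
        - hilbertTransform Ω x * Ω x) * ψ x) + ν * ∫ x, Ω₁ x * deriv ψ x = 0) :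
    ∃ Ω' : ℝ → ℝ, Ω' =ᵐ[volume] Ω ∧ (∀ x, Ω' x = Ω' 0 + ∫ s in (0 : ℝ)..x, Ω₁ s) ∧ hilbertTransform Ω' = hilbertTransform Ω ∧
      ContDiff ℝ 2 Ω' ∧ Integrable Ω' ∧ ∀ X : ℝ, Ω' X + 1 / 2 * X * deriv Ω' X
        + a * (∫ s in (0 : ℝ)..X, hilbertTransform Ω' s) * deriv Ω' X
        - hilbertTransform Ω' X * Ω' X - ν * iteratedDeriv 2 Ω' X = 0 := by
  obtain ⟨c, hc⟩ := ae_eq_const_add_primitive_of_weakDeriv hΩi.locallyIntegrable (hΩ₁.locallyIntegrable one_le_two) hwd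
  set Ω' : ℝ → ℝ := fun x => c + ∫ s in (0 : ℝ)..x, Ω₁ s with hΩ'
  have hae : Ω' =ᵐ[volume] Ω := hc.mono fun x hx => by rw [hΩ', hx]
  have hprim : ∀ x, Ω' x = Ω' 0 + ∫ s in (0 : ℝ)..x, Ω₁ s := fun x => by
    simp only [hΩ', intervalIntegral.integral_same, add_zero]
  have hH : hilbertTransform Ω' = hilbertTransform Ω := hilbertTransform_congr_ae hae
  have hΩ'i : Integrable Ω' := hΩi.congr hae.symm
  have hΩ'2 : MemLp Ω' 2 := hΩ2.ae_eq hae.symm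
  have hweak' : ∀ ψ : ℝ → ℝ, ContDiff ℝ ∞ ψ → HasCompactSupport ψ →
      (∫ x, (Ω' x + 1 / 2 * x * Ω₁ x + a * (∫ s in (0 : ℝ)..x, hilbertTransform Ω' s) * Ω₁ x
        - hilbertTransform Ω' x * Ω' x) * ψ x) + ν * ∫ x, Ω₁ x * deriv ψ x = 0 := by
    intro ψ hψ hψc
    rw [hH]
    have e : ∫ x, (Ω' x + 1 / 2 * x * Ω₁ x + a * (∫ s in (0 : ℝ)..x, hilbertTransform Ω s) * Ω₁ x
        - hilbertTransform Ω x * Ω' x) * ψ x = ∫ x, (Ω x + 1 / 2 * x * Ω₁ x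
        + a * (∫ s in (0 : ℝ)..x, hilbertTransform Ω s) * Ω₁ x - hilbertTransform Ω x * Ω x) * ψ x :=
      integral_congr_ae (hae.mono fun x hx => by simp only [hx])
    rw [e]
    exact hweak ψ hψ hψc
  obtain ⟨hC2, hG⟩ := contDiff_two_and_strongZero_of_weakZero hν hprim hΩ₁ hΩ'i hΩ'2 hweak'
  exact ⟨Ω', hae, hprim, hH, hC2, hΩ'i, hG⟩

/-- **Weak-derivative pair ⇒ exact self-similar viscous gCLM blow-up.** Under the hypotheses of
`exists_strongZero_representative_of_weakDeriv`, if moreover `Ω` is not a.e. zero, the continuous representative `Ω̃ = Ω` a.e. is an exact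
self-similar blow-up profile: for every `T > 0`, `ω(t,x) = (T − t)⁻¹Ω̃(x/√(T − t))` is a classical solution of `ω_t + a u ω_x = u_x ω + ν ω_xx` on
`ℝ × [0,T)` whose sup norm blows up at `T`. MODEL statement; no profile is asserted to exist. [folklore] -/
theorem exact_viscous_selfSimilar_blowup_of_weakDeriv {a ν T : ℝ} {Ω Ω₁ : ℝ → ℝ} (hT : 0 < T) (hν : ν ≠ 0)
    (hΩi : Integrable Ω) (hΩ2 : MemLp Ω 2) (hΩ₁ : MemLp Ω₁ 2) (hne : ¬ Ω =ᵐ[volume] 0)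
    (hwd : ∀ ψ : ℝ → ℝ, ContDiff ℝ ∞ ψ → HasCompactSupport ψ → ∫ x, Ω x * deriv ψ x = -∫ x, Ω₁ x * ψ x)
    (hweak : ∀ ψ : ℝ → ℝ, ContDiff ℝ ∞ ψ → HasCompactSupport ψ →
      (∫ x, (Ω x + 1 / 2 * x * Ω₁ x + a * (∫ s in (0 : ℝ)..x, hilbertTransform Ω s) * Ω₁ x
        - hilbertTransform Ω x * Ω x) * ψ x) + ν * ∫ x, Ω₁ x * deriv ψ x = 0) :
    ∃ Ω' : ℝ → ℝ, Ω' =ᵐ[volume] Ω ∧ ContDiff ℝ 2 Ω' ∧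
      IsGCLMLineSolution a ν (gclmSelfSimilar (-1) (1 / 2) T Ω') T ∧
      SupNormBlowupBefore (gclmSelfSimilar (-1) (1 / 2) T Ω') T := by
  obtain ⟨Ω', hae, -, -, hC2, hΩ'i, hG⟩ := exists_strongZero_representative_of_weakDeriv hν hΩi hΩ2 hΩ₁ hwd hweak
  have hX : ∃ X₀, Ω' X₀ ≠ 0 := by
    by_contra hcon
    exact hne (hae.symm.trans (Eventually.of_forall fun x => not_not.1 (not_exists.1 hcon x)))
  obtain ⟨X₀, hX₀⟩ := hX
  exact ⟨Ω', hae, hC2, SheetRStrongZeroBlowup.exact_viscous_selfSimilar_blowup_of_strongZero hT hC2 hΩ'i hG hX₀⟩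

end SheetRWeakToStrongAE
end Summit.NavierStokesRegularity.OSWSelfSimilar

end
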